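import Summits.ABC.ABC.Theses.TwistAmplification
import Literature.NumberTheory.EllipticCurves.SzpiroLocalDataProofs
import Literature.NumberTheory.EllipticCurves.SzpiroOfAbcProofs

/-!
# `ModerateWindowCount` (stmt-ABC-1973) — negative-side lemmas VIII: reducedness is an honesty clause

Standing-adversary (cdisprove) output. `moderateWindowCountUnreduced_trivial`: with the reducedness clauses
(`a₁, a₃ ∈ {0,1}`, `a₂ ∈ {−1,0,1}`) removed from the counted set, the statement of the crux is TRIVIALLY
TRUE (`C = 0`): every member comes with all its integral translates `x ↦ x + r` (same curve, conductor,
`c₄, c₆, Δ`; still minimal at every place by the general DVR lemma `isMinimal_smul_of_u_eq_one` over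
Mathlib's `MaximalFor` definition of minimality), so every unreduced window is empty or infinite and its
`Set.ncard` is `0`. So a proof of the crux that never uses reducedness proves nothing; the clauses are what
make the count one model per `ℚ`-isomorphism class. (Port to this crux of the sibling file's §8.)
Refuter seat refuter-cdisprove-stmt-ABC-1973-0, 2026-08-16.
-/

namespace Summit.ABC.ABC.Theorems.ModerateWindowCount.Negative

open Summit.ABC.ABC.Theses.TwistAmplification WeierstrassCurve IsDedekindDomain

noncomputable section



section MinimalInvariance

variable {R : Type*} [CommRing R] [IsDomain R] [IsDiscreteValuationRing R]
  {K : Type*} [Field K] [Algebra R K] [IsFractionRing R K]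

/-- Minimality (Mathlib's `IsMinimal`, a `MaximalFor` over all changes of variables) is preserved by a
change of variables with `u = 1` onto an integral equation. [folklore] -/
theorem isMinimal_smul_of_u_eq_one (W : WeierstrassCurve K) [hW : W.IsMinimal R]
    (D : VariableChange K) (hu : D.u = 1) (hint : (D • W).IsIntegral R) : (D • W).IsMinimal R := by
  have hmax := hW.val_Δ_maximal
  haveI : W.IsIntegral R := inferInstance
  have hΔ : (D • W).Δ = W.Δ := by rw [variableChange_Δ, hu]; simp
  have hval : valuation_Δ_aux R (D • W) = valuation_Δ_aux R W := by
    apply Subtype.ext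
    have h1 := valuation_Δ_aux_eq_of_isIntegral R (D • W)
    have h2 := valuation_Δ_aux_eq_of_isIntegral R W
    rw [h1, h2, hΔ]
  refine ⟨⟨by simpa using hint, ?_⟩⟩
  intro C hC hle
  simp only [smul_smul, one_mul] at hC hle ⊢
  rw [hval] at hle ⊢
  have h2 := hmax.2 hC
  simp only [one_smul] at h2
  exact h2 hle

end MinimalInvariance

/-- Integral translate `x ↦ x + r` of an integral model (`u = 1`, `s = t = 0`). [folklore] -/
def tr (W₀ : WeierstrassCurve ℤ) (r : ℤ) : WeierstrassCurve ℤ :=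
  ⟨W₀.a₁, W₀.a₂ + 3 * r, W₀.a₃ + r * W₀.a₁, W₀.a₄ + 2 * r * W₀.a₂ + 3 * r ^ 2,
    W₀.a₆ + r * W₀.a₄ + r ^ 2 * W₀.a₂ + r ^ 3⟩

/-- The translating change of variables over `ℚ`. [folklore] -/
def trVC (r : ℤ) : VariableChange ℚ := ⟨1, (r : ℚ), 0, 0⟩

/-- `tr W₀ r ⊗ ℚ = trVC r • (W₀ ⊗ ℚ)`. [folklore] -/
theorem tr_baseChange (W₀ : WeierstrassCurve ℤ) (r : ℤ) :
    (tr W₀ r).baseChange ℚ = trVC r • W₀.baseChange ℚ := by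
  ext
  · simp [tr, trVC, baseChange, variableChange_a₁]
  · simp [tr, trVC, baseChange, variableChange_a₂]
  · simp [tr, trVC, baseChange, variableChange_a₃]
  · simp [tr, trVC, baseChange, variableChange_a₄]
  · simp [tr, trVC, baseChange, variableChange_a₆]

/-- Translation preserves `c₄`. [folklore] -/
theorem tr_c₄ (W₀ : WeierstrassCurve ℤ) (r : ℤ) : (tr W₀ r).c₄ = W₀.c₄ := by
  simp only [tr, WeierstrassCurve.c₄, WeierstrassCurve.b₂, WeierstrassCurve.b₄]; ring

/-- Translation preserves `c₆`. [folklore] -/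
theorem tr_c₆ (W₀ : WeierstrassCurve ℤ) (r : ℤ) : (tr W₀ r).c₆ = W₀.c₆ := by
  simp only [tr, WeierstrassCurve.c₆, WeierstrassCurve.b₂, WeierstrassCurve.b₄, WeierstrassCurve.b₆]; ring

/-- Translation preserves `Δ`. [folklore] -/
theorem tr_Δ (W₀ : WeierstrassCurve ℤ) (r : ℤ) : (tr W₀ r).Δ = W₀.Δ := by
  simp only [tr, WeierstrassCurve.Δ, WeierstrassCurve.b₂, WeierstrassCurve.b₄, WeierstrassCurve.b₆,
    WeierstrassCurve.b₈]; ring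

/-- Translation preserves ellipticity. [folklore] -/
theorem tr_isElliptic (W₀ : WeierstrassCurve ℤ) [h : (W₀.baseChange ℚ).IsElliptic] (r : ℤ) :
    ((tr W₀ r).baseChange ℚ).IsElliptic := by
  refine ⟨?_⟩
  have := h.isUnit
  rw [baseChange_int_Δ] at this ⊢
  rwa [tr_Δ]

/-- Translation preserves the conductor (a `ℚ`-isomorphism invariant). [folklore] -/
theorem tr_conductorNorm (W₀ : WeierstrassCurve ℤ) [(W₀.baseChange ℚ).IsElliptic] (r : ℤ) :
    ((tr W₀ r).baseChange ℚ).conductorNorm ℤ = (W₀.baseChange ℚ).conductorNorm ℤ := by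
  rw [tr_baseChange]; exact conductorNorm_smul_rat _ _

/-- Translates of a minimal model are minimal. [folklore] -/
theorem tr_isMinimalAt (W₀ : WeierstrassCurve ℤ) (v : HeightOneSpectrum ℤ)
    (h : (W₀.baseChange ℚ).IsMinimalAt v) (r : ℤ) : ((tr W₀ r).baseChange ℚ).IsMinimalAt v := by
  have key : ((tr W₀ r).baseChange ℚ).baseChange (v.adicCompletion ℚ) =
      ((trVC r).baseChange (v.adicCompletion ℚ)) • (W₀.baseChange ℚ).baseChange (v.adicCompletion ℚ) := by
    rw [tr_baseChange]
    simp only [baseChange, VariableChange.baseChange, map_variableChange]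
  have hint : (((trVC r).baseChange (v.adicCompletion ℚ)) •
      (W₀.baseChange ℚ).baseChange (v.adicCompletion ℚ)).IsIntegral (v.adicCompletionIntegers ℚ) := by
    rw [← key]; exact isIntegralAt_baseChange_int v (tr W₀ r)
  unfold IsMinimalAt at h ⊢
  rw [key]
  haveI := h
  exact isMinimal_smul_of_u_eq_one _ _ (by simp [trVC, VariableChange.baseChange, VariableChange.map]) hint

/-- `r ↦ tr W₀ r` is injective (read `r` off `a₂`). [folklore] -/
theorem tr_injective (W₀ : WeierstrassCurve ℤ) : Function.Injective (tr W₀) := by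
  intro r r' h
  have h2 : (tr W₀ r).a₂ = (tr W₀ r').a₂ := by rw [h]
  simp only [tr] at h2
  omega

/-- The crux window WITHOUT the reducedness clauses. [folklore] -/
def windowUnred (κ σ X : ℝ) : Set (WeierstrassCurve ℤ) :=
  {W₀ : WeierstrassCurve ℤ | (W₀.baseChange ℚ).IsElliptic ∧
    (∀ v : HeightOneSpectrum ℤ, (W₀.baseChange ℚ).IsMinimalAt v) ∧
    W₀.c₄ ≠ 0 ∧ W₀.c₆ ≠ 0 ∧
    (((W₀.baseChange ℚ).conductorNorm ℤ : ℕ) : ℝ) ≤ X ∧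
    (((W₀.baseChange ℚ).conductorNorm ℤ : ℕ) : ℝ) ^ κ ≤ ((max |W₀.Δ| (|W₀.c₄| ^ 3) : ℤ) : ℝ) ∧
    ((max |W₀.Δ| (|W₀.c₄| ^ 3) : ℤ) : ℝ) ≤ (((W₀.baseChange ℚ).conductorNorm ℤ : ℕ) : ℝ) ^ σ}

/-- Every translate of a member of an unreduced window is a member. [folklore] -/
theorem tr_mem_windowUnred {κ σ X : ℝ} {W₀ : WeierstrassCurve ℤ} (h : W₀ ∈ windowUnred κ σ X) (r : ℤ) :
    tr W₀ r ∈ windowUnred κ σ X := by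
  obtain ⟨hE, hmin, hc₄, hc₆, hNX, hlo, hhi⟩ := h
  haveI := hE
  refine ⟨tr_isElliptic W₀ r, fun v => tr_isMinimalAt W₀ v (hmin v) r, ?_, ?_, ?_, ?_, ?_⟩
  · rwa [tr_c₄]
  · rwa [tr_c₆]
  · rwa [tr_conductorNorm]
  · rwa [tr_conductorNorm, tr_Δ, tr_c₄]
  · rwa [tr_conductorNorm, tr_Δ, tr_c₄]

/-- Every unreduced window is empty or infinite, so its `ncard` is `0`. [folklore] -/
theorem windowUnred_ncard (κ σ X : ℝ) : Set.ncard (windowUnred κ σ X) = 0 := by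
  rcases (windowUnred κ σ X).eq_empty_or_nonempty with h | ⟨W₀, hW₀⟩
  · rw [h, Set.ncard_empty]
  · apply Set.Infinite.ncard
    exact Set.infinite_of_injective_forall_mem (tr_injective W₀) (fun r => tr_mem_windowUnred hW₀ r)

/-- `ModerateWindowCount` with the reducedness clauses removed. -/
def ModerateWindowCountUnreduced : Prop :=
  ∀ σ : ℝ, 6 < σ → ∃ κ δ C : ℝ, 3 < κ ∧ κ < σ ∧ δ < (σ - κ) / (2 * σ - 6) ∧
    ∀ X : ℝ, 1 ≤ X → (Set.ncard (windowUnred κ σ X) : ℝ) ≤ C * X ^ δ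

/-- **Reducedness is an honesty clause**: the unreduced statement is TRIVIALLY true (`κ := (σ+6)/2`,
`δ := 0`, `C := 0`; every count is `0`). [folklore] -/
theorem moderateWindowCountUnreduced_trivial : ModerateWindowCountUnreduced := by
  intro σ hσ
  refine ⟨(σ + 6) / 2, 0, 0, by linarith, by linarith, div_pos (by linarith) (by linarith), fun X _ => ?_⟩
  rw [windowUnred_ncard]; simp

end

end Summit.ABC.ABC.Theorems.ModerateWindowCount.Negative
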